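import Literature.Analysis.PDE.SchauderInteriorBallAux
import HarnessLib
-- buildfix (bf1-g32) B32-3: comment-only touch to re-dispatch the lane build (prune victim: hub olean removed 22:46Z 08-28; parent of PDE.SchauderInteriorBallHolder (ns-idea-4 06:01Z chain, link 2/5); its own imports are built); declarations byte-identical

/-!
# Tools for the interior Schauder estimate on balls for `C^{2,α}` functions: `C²` cut-off calculus

Topic `Literature/Analysis/PDE`. Auxiliary lemmas for
`Literature.Analysis.PDE.exists_schauder_interior_ball_of_holder` (Gilbarg–Trudinger 2001,
Cor. 6.3 on concentric balls for functions that are only `C^{2,α}` on the big ball), the `C²`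
counterparts of the `C^∞` cut-off tools of `Literature/Analysis/PDE/SchauderInteriorBallAux`:

* `contDiff_mul_of_tsupport_subset` — `χ v` is globally `C^n` when `χ ∈ C^n` is supported in an
  open set on which `v` is `C^n`;
* `fderiv_cutoff_mul_eq_and_iteratedFDeriv_two_cutoff_mul_eq_of_contDiffOn_two` — the Leibniz
  formulas for `D(χ v)(e)` and `D²(χ v)(e, e')` at EVERY point, for `v` of class `C²` on an open
  set containing the compact support of the smooth cut-off `χ` (outside the support both sides
  vanish; near it `v` is replaced by the globally `C²` modification `ψ v`, `ψ = 1` near the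
  support);
* `holderOnWith_apply_vecCons_two` — evaluating a Hölder-on-a-set family of continuous bilinear
  maps at two short vectors (set version of the tree's `HolderWith.apply_vecCons_two`).

Everything is proved; no named facts.

## References

* D. Gilbarg, N. S. Trudinger, *Elliptic Partial Differential Equations of Second Order* (2001),
  §6.1. [GilbargTrudinger2001]
-/

noncomputable section

open Filter Function Metric Set
open scoped NNReal ContDiff Topology
open Literature.Analysis.FunctionSpaces

namespace Literature.Analysis.PDE

/-! ### Cut-off products with a function `C^n` / `C²` on an open set -/

section Cutoff

variable {E : Type*} [NormedAddCommGroup E] [NormedSpace ℝ E]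

/-- `χ v` is globally `C^n` when `χ ∈ C^n` has support inside an open set on which `v` is `C^n`
(outside the open set the product vanishes near every point). [folklore] -/
theorem contDiff_mul_of_tsupport_subset {n : WithTop ℕ∞} {χ v : E → ℝ} {U : Set E}
    (hχ : ContDiff ℝ n χ) (hU : IsOpen U) (hv : ContDiffOn ℝ n v U) (hχU : tsupport χ ⊆ U) :
    ContDiff ℝ n fun y => χ y * v y := by
  rw [contDiff_iff_contDiffAt]
  intro y
  by_cases hy : y ∈ U
  · exact hχ.contDiffAt.mul (hv.contDiffAt (hU.mem_nhds hy))
  · have hy' : y ∉ tsupport χ := fun h => hy (hχU h)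
    have hev : (fun y => χ y * v y) =ᶠ[𝓝 y] fun _ => (0 : ℝ) := by
      filter_upwards [notMem_tsupport_iff_eventuallyEq.1 hy'] with z hz
      simp [hz]
    exact (contDiffAt_const (c := (0 : ℝ))).congr_of_eventuallyEq hev

variable [FiniteDimensional ℝ E]

/-- **Leibniz formulas for a cut-off product, valid everywhere, `C²` version.** For `v` of class
`C²` on an open set `U`, a compact `K ⊆ U` and a `C^∞` cut-off `χ` with `tsupport χ ⊆ K`, at
every point `D(χ v)(e) = Dv(e) χ + v Dχ(e)` and
`D²(χ v)(e, e') = D²v(e, e') χ + (Dv(e') Dχ(e) + Dv(e) Dχ(e') + v D²χ(e, e'))`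
(off `K` both sides vanish; near `K` one replaces `v` by the globally `C²` modification `ψ v`,
`ψ = 1` near `K`, and uses the global Leibniz rule). [folklore] -/
theorem fderiv_cutoff_mul_eq_and_iteratedFDeriv_two_cutoff_mul_eq_of_contDiffOn_two
    {χ v : E → ℝ} {U K : Set E} (hχ : ContDiff ℝ ∞ χ) (hU : IsOpen U)
    (hv : ContDiffOn ℝ 2 v U) (hK : IsCompact K) (hKU : K ⊆ U) (hχK : tsupport χ ⊆ K) :
    (∀ x e, fderiv ℝ (fun y => χ y * v y) x e = fderiv ℝ v x e * χ x + v x * fderiv ℝ χ x e) ∧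
    ∀ x e e', iteratedFDeriv ℝ 2 (fun y => χ y * v y) x ![e, e'] =
      iteratedFDeriv ℝ 2 v x ![e, e'] * χ x + (fderiv ℝ v x e' * fderiv ℝ χ x e +
        fderiv ℝ v x e * fderiv ℝ χ x e' + v x * iteratedFDeriv ℝ 2 χ x ![e, e']) := by
  -- a second cut-off `ψ = 1` near `K` and the modification `ψ v`
  obtain ⟨ψ, hψ, -, hψU, hψ1, -⟩ := exists_contDiff_one_nhdsSet_of_isCompact hK hU hKU
  have h2top : ((2 : ℕ) : WithTop ℕ∞) ≤ ((⊤ : ℕ∞) : WithTop ℕ∞) := WithTop.coe_le_coe.mpr le_top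
  have hψ2 : ContDiff ℝ 2 ψ := hψ.of_le (by exact_mod_cast h2top)
  have hχ2 : ContDiff ℝ 2 χ := hχ.of_le (by exact_mod_cast h2top)
  have hvt2 : ContDiff ℝ 2 fun y => ψ y * v y := contDiff_mul_of_tsupport_subset hψ2 hU hv hψU
  have hvtd : Differentiable ℝ fun y => ψ y * v y := hvt2.differentiable (by norm_num)
  have hχd : Differentiable ℝ χ := hχ2.differentiable (by norm_num)
  -- `χ v = χ (ψ v)` everywhere
  have hw_eq : (fun y => χ y * v y) = fun y => χ y * (ψ y * v y) := by
    funext y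
    by_cases hy : χ y = 0
    · simp [hy]
    · have hyK : y ∈ K := hχK (subset_closure (mem_support.2 hy))
      rw [hψ1.self_of_nhdsSet y hyK, one_mul]
  -- `ψ v = v` near every point of `K`
  have hev : ∀ x ∈ K, (fun y => ψ y * v y) =ᶠ[𝓝 x] v := fun x hx => by
    filter_upwards [hψ1.filter_mono (nhds_le_nhdsSet hx)] with y hy
    rw [hy, one_mul]
  -- vanishing off `K`
  have hsupp : tsupport (fun y => χ y * v y) ⊆ K := tsupport_mul_subset_left.trans hχK
  have hz0 : ∀ x ∉ K, χ x = 0 := fun x hx => image_eq_zero_of_notMem_tsupport fun h => hx (hχK h)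
  have hz1 : ∀ x ∉ K, fderiv ℝ χ x = 0 := fun x hx =>
    fderiv_of_notMem_tsupport ℝ fun h => hx (hχK h)
  have hz2 : ∀ x ∉ K, iteratedFDeriv ℝ 2 χ x = 0 := fun x hx =>
    image_eq_zero_of_notMem_tsupport fun h => hx (hχK (tsupport_iteratedFDeriv_subset 2 h))
  have hzw1 : ∀ x ∉ K, fderiv ℝ (fun y => χ y * v y) x = 0 := fun x hx =>
    fderiv_of_notMem_tsupport ℝ fun h => hx (hsupp h)
  have hzw2 : ∀ x ∉ K, iteratedFDeriv ℝ 2 (fun y => χ y * v y) x = 0 := fun x hx =>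
    image_eq_zero_of_notMem_tsupport fun h => hx (hsupp (tsupport_iteratedFDeriv_subset 2 h))
  refine ⟨fun x e => ?_, fun x e e' => ?_⟩
  · by_cases hx : x ∈ K
    · rw [hw_eq, fderiv_mul_apply_eq hχd hvtd x e, (hev x hx).fderiv_eq, (hev x hx).eq_of_nhds]
      ring
    · rw [hzw1 x hx, hz1 x hx, hz0 x hx]
      simp
  · by_cases hx : x ∈ K
    · rw [hw_eq, iteratedFDeriv_two_mul_apply_eq hχ2 hvt2 x e e', (hev x hx).fderiv_eq,
        ((hev x hx).iteratedFDeriv ℝ 2).eq_of_nhds, (hev x hx).eq_of_nhds]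
      ring
    · rw [hzw2 x hx, hz2 x hx, hz1 x hx, hz0 x hx]
      simp

end Cutoff

/-! ### Hölder bookkeeping: entries of a Hölder-on-a-set family of bilinear maps -/

section Holder

variable {E : Type*} [NormedAddCommGroup E] [NormedSpace ℝ E] {F : Type*} [NormedAddCommGroup F]
  [NormedSpace ℝ F]

/-- Evaluating an `r`-Hölder-on-`s` family of continuous bilinear maps at two vectors of norm
`≤ 1` gives an `r`-Hölder-on-`s` function with the same constant (set version of the tree's
`HolderWith.apply_vecCons_two`). [folklore] -/
theorem holderOnWith_apply_vecCons_two {D : E → E [×2]→L[ℝ] F} {C r : ℝ≥0} {s : Set E}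
    (hD : HolderOnWith C r D s) {v w : E} (hv : ‖v‖ ≤ 1) (hw : ‖w‖ ≤ 1) :
    HolderOnWith C r (fun x => D x ![v, w]) s := by
  refine holderOnWith_of_dist_le_rpow fun x hx y hy => ?_
  calc dist (D x ![v, w]) (D y ![v, w]) = ‖(D x - D y) ![v, w]‖ := by
        rw [dist_eq_norm, sub_apply]
    _ ≤ ‖D x - D y‖ * ∏ i, ‖(![v, w] : Fin 2 → E) i‖ := ContinuousMultilinearMap.le_opNorm _ _
    _ ≤ ‖D x - D y‖ * 1 := by
        gcongr
        rw [Fin.prod_univ_two]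
        simp only [Matrix.cons_val_zero, Matrix.cons_val_one]
        exact mul_le_one₀ hv (norm_nonneg _) hw
    _ = dist (D x) (D y) := by rw [mul_one, dist_eq_norm]
    _ ≤ C * dist x y ^ (r : ℝ) := hD.dist_le hx hy

end Holder

end Literature.Analysis.PDE
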